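import Summits.AtomisticToContinuum.HydrodynamicLimit.Theses.OneFlightGossipEngine
import Summits.AtomisticToContinuum.HydrodynamicLimit.Theorems.TransferActivityTails.Negative.EquilibriumReduction
import Summits.AtomisticToContinuum.HydrodynamicLimit.Theorems.OneFlightGossipEngineCollisionActivityTailsMeanEnergyBound
import Summits.AtomisticToContinuum.HydrodynamicLimit.Theorems.OneFlightGossipEngineCollisionActivityTailsActMeasurable
import Literature.Analysis.FluidPDE.HardSphereCollisionRecordMeasurable
import HarnessLib

/-!
# Skeleton of line `coboundary-hot-cold-split` (payload slug `Sketch`, ideator-1 card) for the crux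
# `EnergyActivityTails` (stmt-AtomisticToContinuum-17703) — lead prover-line-stmt-AtomisticToContinuum-17703-0, v1

Crux decl (concluded BY NAME by `EnergyActivityTails_of`):
`Summit.AtomisticToContinuum.HydrodynamicLimit.Theses.OneFlightGossipEngine.EnergyActivityTails` (= `TailsOf energyOf`, `Iff.rfl`).

## The line in one paragraph

Per collision of `i` (record `c`, `c.fst = i`, read off a contact configuration), the energy impulse
`|‖v⁺‖² − ‖v⁻‖²|/2 = |g|` with `g` the signed GAIN satisfies `|g| = 2g⁺ − g`; the GAIN is bounded one-sidedly by the
PARTNER's incoming normal speed times the momentum impulse, `g⁺ ≤ ‖Δv‖ · |⟪v_partner⁻, ω⟫|` (K1, elastic law swaps normal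
components), and the signed gains TELESCOPE along the orbit, `Σ_{(a,b]} g = (‖v_i(b)‖² − ‖v_i(a)‖²)/2` (K2, coboundary).
Splitting the collisions of `i` by the partner's normal speed at a cap `M` gives the PATHWISE SPLIT (K3)
`Σ|ΔE_i| ≤ ‖v_i(a)‖²/2 + 2M·Σ‖Δv_i‖ + 2·Σ hotSupply_M`, `hotSupply_M` = the gain received from a partner arriving with
normal speed `> M`.  In the crux frame (`× σ/τ`, tail functional `y𝟙{y > V} ≤ 3Σ tails at V/3`): the endpoint term has
mean `≤ 3(σ/τ)e₀ → 0` (energy conservation + the landed `MeanEnergyBound`), the middle term is the momentum twin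
`CollisionActivityTails` (crux stmt-13734, leaned) at level `V/(6M)`, and the last is the HOT-SUPPLY TAIL `HotSupplyTailsIn`
(cap `M` chosen INSIDE the frame after `t`, before `V₀` — no quantifier inversion) — the line's one open leaf (K4).
Given CAT, `EAT ⟺ HotSupplyTailsIn` (the converse domination is `Iff`-cheap: `hotSupplyOf ≤ energyOf`).

## Stubs (registered; `stub_*` are the only sorries)
* `stub_recordGain` (K1, record kinematics at contact) — closable, S.
* `stub_coboundary` (K2, telescoping of the signed gains along a good orbit) — closable, M (enumeration API of
  `HardSphereJumpTelescoping` / `HardSphereWindowEnumeration`).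
* `stub_pathwiseSplit` (K3 from K1 + K2 + collision-sum algebra on the good set) — closable, S/M.
* `stub_hotSupplyMeasurable` (the hot-supply window sum is measurable in the datum, `0` off the good set) — closable port of
  `TransferActivityTailsTaggedSumMeasurable.measurable_indicator_collisionSum_Ioc`, S.
* `stub_tailAssembly` (K4: K3 + measurability + `MeanEnergyBound` + energy conservation ⇒ (CAT → HSTin → EAT)) — closable, M
  (template: `crux_of_branches` of the CAT skeleton).
* `stub_collisionActivityTails` — the momentum twin = crux stmt-AtomisticToContinuum-13734 (LEANED; its own lead; not worked here).
* `stub_hotSupplyTailsIn` — OPEN leaf (lead's own): L¹ tails of the window energy supply from hot-normal partners under the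
  TRUE pre-shock law; weaker than the crux (`hotSupplyTailsIn_of_energyActivityTails`, proved).
-/

noncomputable section

open MeasureTheory Filter Set Topology
open scoped ENNReal InnerProductSpace

namespace Summit.AtomisticToContinuum.HydrodynamicLimit.Theorems.EnergyActivityTailsHotColdSplit

open Literature.MathematicalPhysics.KineticTheory Literature.Analysis.FluidPDE
open Summit.AtomisticToContinuum.HydrodynamicLimit.Theorems.TransferActivityTailsNegative
  (Flow Rec energyOf momentumOf TailsOf tailsOf_of_le energyOf_nonneg)

/-! ## §0 Vocabulary -/

/-- Configurations of `N + 1` spheres on `𝕋³`. -/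
abbrev Cfg (N : ℕ) : Type := Config (N + 1) (Fin 3) T3

variable {N : ℕ}

/-- Signed kinetic-energy change of `fst` in the record `c` (the GAIN of `i`; `energyOf = |gainOf|`). -/
def gainOf (N : ℕ) (i : Fin (N + 1)) (c : Rec N) : ℝ :=
  if c.fst = i then (‖c.postVel.1‖ ^ 2 - ‖c.preVel.1‖ ^ 2) / 2 else 0

/-- **Hot supply at cap `M`**: the energy RECEIVED by `i` (positive part of its gain) in a collision whose partner arrives
with normal speed `|⟪v_snd⁻, ω⟫| > M` (`ω = c.impactVec`, a unit vector at contact); zero on every collision with a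
cold-normal partner. -/
def hotSupplyOf (M : ℝ) (N : ℕ) (i : Fin (N + 1)) (c : Rec N) : ℝ :=
  if c.fst = i ∧ M < |⟪c.preVel.2, c.impactVec⟫_ℝ| then max ((‖c.postVel.1‖ ^ 2 - ‖c.preVel.1‖ ^ 2) / 2) 0 else 0

/-- `HSTin` — **hot-supply tails, cap inside the frame**: the crux's frame verbatim with the summand `hotSupplyOf M` and
`∃ M > 0` inserted after `t` (before `V₀`), so that "hot" means hot relative to THIS solution on `[0, t]`. -/
def HotSupplyTailsIn : Prop :=
  ∀ (a₀ θ₀ : T3 → ℝ) (u₀ : T3 → V3), Continuous a₀ → Continuous θ₀ → Continuous u₀ →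
    (∀ x, 0 < a₀ x) → (∀ x, 0 < θ₀ x) → ∃ σ₀ : ℝ, 0 < σ₀ ∧ ∀ σ : ℝ, 0 < σ → σ < σ₀ →
    ∀ (T : ℝ) (ρ θ : ℝ → T3 → ℝ) (u : ℝ → T3 → V3), IsHardSphereEulerSolution σ T ρ u θ →
    ∀ Φ : (N : ℕ) → Flow σ N,
    TendstoHydroFieldsAt (fun N => localGibbsLaw σ a₀ u₀ θ₀ N (Φ N)) Φ ρ u θ 0 →
    ∀ t ∈ Set.Ico 0 T, ∃ M : ℝ, 0 < M ∧ ∃ V₀ : ℝ, 0 < V₀ ∧ ∀ V : ℝ, V₀ ≤ V → ∀ ε : ℝ, 0 < ε →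
    ∃ τ₀ : ℝ, 0 < τ₀ ∧ ∀ τ : ℝ, τ₀ ≤ τ → ∃ N₀ : ℕ, ∀ N : ℕ, N₀ ≤ N → ∀ s ∈ Set.Icc 0 t,
      ∫⁻ z, ENNReal.ofReal (((N : ℝ) + 1)⁻¹ * ∑ i : Fin (N + 1),
          Set.indicator {y : ℝ | V < y} (fun y => y)
            (σ / τ * (Φ N).collisionSum (Set.Ioc s (s + τ * ((N : ℝ) + 1) ^ (-(1 / 3 : ℝ))))
              (hotSupplyOf M N i) z))
        ∂(localGibbsLaw σ a₀ u₀ θ₀ N (Φ N)) ≤ ENNReal.ofReal ε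

/-! ## §1 The statements of the closable stubs -/

/-- **K1 — RECORD GAIN BOUND (record kinematics at contact).** For a record read off a contact configuration of `N + 1`
spheres of diameter `hsDiameter σ N > 0`: the positive part of the first partner's energy gain is at most its momentum
impulse times the partner's incoming normal speed, `g⁺ ≤ ‖v_fst⁺ − v_fst⁻‖ · |⟪v_snd⁻, ω⟫|` (the elastic law swaps the normal
components, `g = (ν_snd² − ν_fst²)/2`, `‖Δv_fst‖ = |ν_snd − ν_fst|`, `‖ω‖ = 1`). -/
def RecordGain : Prop :=
  ∀ (σ : ℝ), 0 < σ → ∀ (N : ℕ) (z : Cfg N) (t : ℝ) (i j : Fin (N + 1)),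
    z ∈ contactSet (Torus.geometry (Fin 3)) (N + 1) (hsDiameter σ N) i j →
    max ((‖(HardSphereCollisionRecord.ofConfig (Torus.geometry (Fin 3)) (hsDiameter σ N) z t i j).postVel.1‖ ^ 2 -
          ‖(HardSphereCollisionRecord.ofConfig (Torus.geometry (Fin 3)) (hsDiameter σ N) z t i j).preVel.1‖ ^ 2) / 2) 0 ≤
      ‖(HardSphereCollisionRecord.ofConfig (Torus.geometry (Fin 3)) (hsDiameter σ N) z t i j).postVel.1 -
          (HardSphereCollisionRecord.ofConfig (Torus.geometry (Fin 3)) (hsDiameter σ N) z t i j).preVel.1‖ *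
        |⟪(HardSphereCollisionRecord.ofConfig (Torus.geometry (Fin 3)) (hsDiameter σ N) z t i j).preVel.2,
          (HardSphereCollisionRecord.ofConfig (Torus.geometry (Fin 3)) (hsDiameter σ N) z t i j).impactVec⟫_ℝ|

/-- **K2 — COBOUNDARY (telescoping of the signed gains).** Along a good orbit of a hard-sphere flow on `𝕋³`
(`0 < σ < 1/2`, so the geometry is regular and collisions are binary) the window sum over `(a, b]` of `i`'s signed energy
gains is the change of `i`'s kinetic energy across the window (velocities jump only at `i`'s own collisions; pre-collisional
velocities are flight velocities, `HardSphereFlow.preVel_partner_nthCollisionTimeOf_zero/succ`). -/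
def Coboundary : Prop :=
  ∀ (σ : ℝ), 0 < σ → σ < 1 / 2 → ∀ (N : ℕ) (Φ : Flow σ N) (z : Cfg N), z ∈ Φ.good →
    ∀ (a b : ℝ), a ≤ b → ∀ i : Fin (N + 1),
      Φ.collisionSum (Set.Ioc a b) (gainOf N i) z = (‖(Φ.flow b z i).2‖ ^ 2 - ‖(Φ.flow a z i).2‖ ^ 2) / 2

/-- **K3 — PATHWISE SPLIT at a cap `M ≥ 0`.** For every good orbit, window `(a, b]` and particle:
`Σ|ΔE_i| ≤ ‖v_i(a)‖²/2 + 2M·Σ‖Δv_i‖ + 2·Σ hotSupply_M` (`|g| = 2g⁺ − g`, K2 for `Σ g`, K1 on the cold-normal collisions). -/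
def PathwiseSplit : Prop :=
  ∀ (M : ℝ), 0 ≤ M → ∀ (σ : ℝ), 0 < σ → σ < 1 / 2 → ∀ (N : ℕ) (Φ : Flow σ N) (z : Cfg N), z ∈ Φ.good →
    ∀ (a b : ℝ), a ≤ b → ∀ i : Fin (N + 1),
      Φ.collisionSum (Set.Ioc a b) (energyOf N i) z ≤
        ‖(Φ.flow a z i).2‖ ^ 2 / 2 + 2 * M * Φ.collisionSum (Set.Ioc a b) (momentumOf N i) z +
          2 * Φ.collisionSum (Set.Ioc a b) (hotSupplyOf M N i) z

/-- **MEASURABILITY OF THE HOT SUPPLY** (window sum over any `(a, b]`, extended by `0` off the good set; `0 < σ < 1/2`). -/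
def HotSupplyMeasurable : Prop :=
  ∀ (σ : ℝ), 0 < σ → σ < 1 / 2 → ∀ (M : ℝ) (N : ℕ) (Φ : Flow σ N) (i : Fin (N + 1)) (a b : ℝ),
    Measurable (Φ.good.indicator fun z => Φ.collisionSum (Set.Ioc a b) (hotSupplyOf M N i) z)

/-! ## §2 Cheap facts (proved) -/

theorem hotSupplyOf_nonneg (M : ℝ) (N : ℕ) (i : Fin (N + 1)) (c : Rec N) : 0 ≤ hotSupplyOf M N i c := by
  unfold hotSupplyOf; split_ifs
  · exact le_max_right _ _
  · exact le_rfl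

theorem hotSupplyOf_le_energyOf (M : ℝ) (N : ℕ) (i : Fin (N + 1)) (c : Rec N) :
    hotSupplyOf M N i c ≤ energyOf N i c := by
  unfold hotSupplyOf energyOf
  by_cases hi : c.fst = i
  · simp only [hi, true_and, if_true]
    split_ifs
    · refine max_le ?_ (by positivity)
      exact div_le_div_of_nonneg_right (le_abs_self _) (by norm_num)
    · positivity
  · simp [hi]

/-- **`EAT ⇒ HSTin`** (domination + `M := 1`): the leaf is WEAKER than the crux. -/
theorem hotSupplyTailsIn_of_energyActivityTails
    (h : Summit.AtomisticToContinuum.HydrodynamicLimit.Theses.OneFlightGossipEngine.EnergyActivityTails) :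
    HotSupplyTailsIn := by
  have h1 : TailsOf (hotSupplyOf 1) := tailsOf_of_le (hotSupplyOf_nonneg 1) (hotSupplyOf_le_energyOf 1) h
  intro a₀ θ₀ u₀ ha hθ hu ha0 hθ0
  obtain ⟨σ₀, hσ₀, H⟩ := h1 a₀ θ₀ u₀ ha hθ hu ha0 hθ0
  refine ⟨σ₀, hσ₀, fun σ hσ hσlt T ρ θ u hE Φ hlim t ht => ⟨1, one_pos, ?_⟩⟩
  exact H σ hσ hσlt T ρ θ u hE Φ hlim t ht

/-! ## §3 The stubs -/

/-- **STUB K1 — record gain bound** (closable: `gain_pos_le_impulse_mul_partnerNormal` of the ideator sketch +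
`norm_ofConfig_impactVec`, `ofConfig_preVel/postVel/impactVec`). -/
theorem stub_recordGain : RecordGain := by
  sorry

/-- **STUB K2 — coboundary** (closable: window shift `collisionSum_Ioc_eq_collisionSum_flow`, binary collisions
`contactPairs_eq_pair`/`participates_iff`, enumeration `nthCollisionTimeOf` + `sum_range_ncard_nthTimeAfter`, flight velocities
`preVel_partner_nthCollisionTimeOf_zero/_succ`, `vel_flow_eq_of_forall_not_participates`, `Finset.sum_range_sub`). -/
theorem stub_coboundary : Coboundary := by
  sorry

/-- **STUB K3 — pathwise split** (closable from K1, K2: `collisionSum_eq_finset_sum` on the good set, record-by-record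
`|g| = 2g⁺ − g`, `g⁺ ≤ M·‖Δv‖` resp. `g⁺ = hotSupply` by cases on `|⟪v_snd⁻, ω⟫| ≤ M`). -/
theorem stub_pathwiseSplit : RecordGain → Coboundary → PathwiseSplit := by
  sorry

/-- **STUB — measurability of the hot supply** (closable: `measurable_indicator_collisionSum_Ioc` with the measurable,
time-stamp-blind functional `hotSupplyOf M N i`). -/
theorem stub_hotSupplyMeasurable : HotSupplyMeasurable := by
  sorry

/-- **STUB K4 — tail assembly** (closable; template `crux_of_branches` of the CAT skeleton): in the crux frame, a.e. on the good set
`𝟙{V<aᵉ}aᵉ ≤ 3(σ/τ)‖v_i(s)‖²/2 + 6M·𝟙{V/(6M) < aᵐ}aᵐ + 6·𝟙{V/6 < h}h` (K3 at cap `M`, `y𝟙{V<y} ≤ 3 max`), one `lintegral` split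
(`aemeasurable_act`, `HotSupplyMeasurable`), endpoint mean `≤ 3(σ/τ)e₀` (`configEnergy_flow` + `stub_meanEnergyBound`), CAT at level
`V/(6M) ≥ V₀ᵐ` accuracy `ε/(18M)`, HSTin at level `V/6 ≥ V₀ʰ` accuracy `ε/18`; `σ₀ := min σ₀ᵐ σ₀ʰ (1/2)`, `V₀ := max (6M V₀ᵐ) (6V₀ʰ)`,
`τ₀ := max τ₀ᵐ τ₀ʰ (9σe₀/ε)`, `N₀ := max`. -/
theorem stub_tailAssembly : PathwiseSplit → HotSupplyMeasurable →
    Summit.AtomisticToContinuum.HydrodynamicLimit.Theses.OneFlightGossipEngine.CollisionActivityTails →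
    HotSupplyTailsIn →
    Summit.AtomisticToContinuum.HydrodynamicLimit.Theses.OneFlightGossipEngine.EnergyActivityTails := by
  sorry

/-- **STUB (LEANED CRUX) — the momentum twin `CollisionActivityTails`** = crux stmt-AtomisticToContinuum-13734 of this route (own lead,
line `plaque-thinning-count-ld`); not worked in this line. -/
theorem stub_collisionActivityTails :
    Summit.AtomisticToContinuum.HydrodynamicLimit.Theses.OneFlightGossipEngine.CollisionActivityTails := by
  sorry

/-- **STUB (OPEN LEAF) — hot-supply tails, cap inside the frame.** -/
theorem stub_hotSupplyTailsIn : HotSupplyTailsIn := by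
  sorry

/-! ## §4 The composition -/

/-- **`EnergyActivityTails_of`** — the skeleton concludes the crux BY NAME from the registered stubs. -/
theorem EnergyActivityTails_of :
    Summit.AtomisticToContinuum.HydrodynamicLimit.Theses.OneFlightGossipEngine.EnergyActivityTails :=
  stub_tailAssembly (stub_pathwiseSplit stub_recordGain stub_coboundary) stub_hotSupplyMeasurable
    stub_collisionActivityTails stub_hotSupplyTailsIn

end Summit.AtomisticToContinuum.HydrodynamicLimit.Theorems.EnergyActivityTailsHotColdSplit

end
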